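import Literature.NumberTheory.LFunctions.Zhang2022.Section10Lemma102LogMean
import Literature.NumberTheory.LFunctions.Zhang2022.Section8XiZeroTailMean
import Literature.NumberTheory.LFunctions.Zhang2022.Section10Eq1011Window
import Literature.NumberTheory.LFunctions.Zhang2022.Section10Range1113
import HarnessLib

/-!
# Zhang (2022), Lemma 10.2 — the edge windows (10.11): the DERIVABLE weak bound for `𝔳₂ⱼ(d,r)` on
# `dr < P^{0.504}`, from LEMMA A and the absolute tail mean of `ξ₀ⱼ`

Topic `Literature/NumberTheory/LFunctions/Zhang2022` (Landau–Siegel audit tree; verdict-neutral).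
Y. Zhang, *Discrete mean estimates and the Landau–Siegel zero*, arXiv:2211.02515v1 (2022)
[Zhang2022LandauSiegel] — **an unrefereed manuscript under adjudication**; DAG node `Z22:(10.11)`
[Z22 p.55 tex L2817, proof sentence p.56 tex L2853: "The proof of (10.11) is similar to that of (10.5)"
— no display]; campaign row G-d60-1 ("not-in-print"; the typed uniform bound
`Typed.Sec10A.Eq1011` / clause 4 of `Skeleton.Lemma102` is underivable as typed). ZHANG-L discharge
lane (WP10, leaf `h102`).

WHAT IS PROVED (and why it is the honest form of (10.11)). By the tent decomposition
(`Lemma102.frakv2_eq_logMeans`), `𝔳₂ⱼ(d,r) = (500/log P)(A(X₁) − 2A(X₂) + A(X₃))` with the log-means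
`A(X) = Σ_{n≤X} χ(n)ξ₀ⱼ(n;d,r)n⁻¹log(X/n)` at `X_k = P^{a_k}/(dr)`, `a = (0.504, 0.502, 0.5)`. For every
`d, r ≥ 1` with `dr < P^{0.504} = P₁` (a superset of the three printed windows) EACH `A(X_k)` is bounded
by ONE of three devices: `X < 1` ⇒ `A = 0`; `1 ≤ X ≤ T` ⇒ the crude bound `|A| ≤ log X·Σ_{n<X}|ξ₀ⱼ|/n`
with the tree's unconditional tail mean `XiZeroMajorant.xiZeroTailMean` (`≪ 𝓛(1+log X)³`), giving
`|A| ≤ C_ξ𝓛(1+𝓛^{1.1})⁴`; `T ≤ X ≤ P` ⇒ LEMMA A (`Lemma102.logMeanRel_of_lemma83Rel`, from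
`Skeleton.Lemma83Rel`) whose main term has size `|L′(1,χ)||Π(d,r)|(1 + 2b₀ + b₀²/2) ≪ 𝓛²R(d,r)`
(`‖β_i‖log P ≤ b₀ = 3π(1+5|c′|π)`, `Typed.Sec10A.norm_betaJ_mul_ell9_le`; `|Π| ≤ R`,
`R(d,r) = (∏_{q∣dr}(1−q⁻¹)⁻¹)²`). Hence (`frakv2_low_le_of_lemma83Rel`)

  `‖𝔳₂ⱼ(d,r)‖ ≤ C·𝓛(1 + 𝓛^{1.1})⁴(𝓛⁹)⁻¹·R(d,r)`   (`≈ 16C·𝓛^{−3.6}R`)   for `1 ≤ dr < P^{0.504}`,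

and in particular on the three windows of (10.11) (`frakv2_windows_le_of_lemma83Rel`, hypothesis
shaped as clause 4 of `Skeleton.Lemma102`). This is WEAKER than the printed `O(𝓛⁻⁷)`: on each window
one log-mean has `1 ≤ X < T`, where no contour evaluation is available (the left-line term
`e^{−η log X}` does not decay), and the manuscript displays no proof. It is what the method gives and
what the consumers can afford: a window has log-length `log T = 𝓛^{1.1}` against the `m`-sum's `𝓛⁻⁷`,
so the window contribution to `S_j` is `≈ 𝓛^{1.1−7−3.6}·(weights) = o(α)` — the same bookkeeping as
L3-t4's `Section10CRanges1422` Part NB (which treats its windows by the same tail mean).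

Theorem-only; no definitions, no named facts. Nothing about the manuscript's Theorems 1–2 or about
Landau–Siegel zeros is asserted.

## References

* Y. Zhang, arXiv:2211.02515v1 (2022), §10 Lemma 10.2 (10.11) p. 55 and p. 56; §7 p. 13 (`ξ₀ⱼ`).
  [cite: Zhang2022LandauSiegel, §10 Lemma 10.2 (10.11)]
-/

noncomputable section

open Complex Real Finset

namespace Literature.NumberTheory.LFunctions.Zhang2022.Lemma102

open Skeleton

/-! ### Two pointwise bounds for a log-mean -/

section Pointwise

variable (c' : ℝ) {D : ℕ} [NeZero D] (χ : DirichletCharacter ℂ D)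

omit [NeZero D] in
/-- **Crude bound for a log-mean below `T`**: for `X ≥ 1`,
`|Σ_{n≤X} χ(n)ξ₀ⱼ(n;d,r)n⁻¹log(X/n)| ≤ log X · Σ_{n<X}|ξ₀ⱼ(n;d,r)|/n` (the term `n = X` carries
`log 1 = 0`; `|χ| ≤ 1`, `0 ≤ log(X/n) ≤ log X`). [cite: Zhang2022LandauSiegel, §10 Lemma 10.2 (10.11)] -/
theorem norm_logMean_le_log_mul_tail (j d r : ℕ) {X : ℝ} (hX : 1 ≤ X) :
    ‖∑ n ∈ Finset.Ioc 0 ⌊X⌋₊, χ (n : ZMod D) * xiZero c' D j n d r / (n : ℂ) *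
        (Real.log (X / n) : ℂ)‖ ≤
      Real.log X * ∑ n ∈ Finset.Ico 1 ⌈X⌉₊, ‖xiZero c' D j n d r‖ / n := by
  have hX0 : 0 < X := by linarith
  rw [← Lemma84.sum_Ico_eq_sum_Ioc (fun n => χ (n : ZMod D) * xiZero c' D j n d r / (n : ℂ)) hX0,
    Finset.mul_sum]
  refine (norm_sum_le _ _).trans (Finset.sum_le_sum fun n hn => ?_)
  have hn1 : 1 ≤ n := (Finset.mem_Ico.mp hn).1
  have hn0 : (0 : ℝ) < n := by exact_mod_cast hn1
  have hnX : (n : ℝ) ≤ X := by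
    have := (Finset.mem_Ico.mp hn).2
    have h := Nat.lt_ceil.mp this
    exact h.le
  have hlog0 : 0 ≤ Real.log (X / n) := Real.log_nonneg (by rw [le_div_iff₀ hn0]; linarith)
  have hlogle : Real.log (X / n) ≤ Real.log X := by
    apply Real.log_le_log (div_pos hX0 hn0)
    exact div_le_self hX0.le (by exact_mod_cast hn1)
  rw [norm_mul, norm_div, norm_mul, Complex.norm_natCast, Complex.norm_real,
    Real.norm_of_nonneg hlog0]
  have hχ := χ.norm_le_one (n : ZMod D)
  calc ‖χ (n : ZMod D)‖ * ‖xiZero c' D j n d r‖ / n * Real.log (X / n)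
      ≤ 1 * ‖xiZero c' D j n d r‖ / n * Real.log X := by gcongr
    _ = Real.log X * (‖xiZero c' D j n d r‖ / n) := by ring

/-- **Size of LEMMA A's main term**: if `‖β_{j+1}‖L, ‖β_{j+2}‖L ≤ b₀` (`L = log X ≥ 0`) then
`‖L′(1,χ)Π(d,r)(1 + (β_{j+1}+β_{j+2})L + ½β_{j+1}β_{j+2}L²)‖ ≤ ‖L′(1,χ)‖‖Π(d,r)‖(1 + 2b₀ + b₀²/2)`.
[cite: Zhang2022LandauSiegel, §10 Lemma 10.2] -/
theorem norm_logMean_main_le (j d r : ℕ) {L b₀ : ℝ} (hL : 0 ≤ L) (hb₀ : 0 ≤ b₀)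
    (ha : ‖betaJ c' D (j + 1)‖ * L ≤ b₀) (hb : ‖betaJ c' D (j + 2)‖ * L ≤ b₀) :
    ‖deriv χ.LFunction 1 * PiW χ d r *
        (1 + (betaJ c' D (j + 1) + betaJ c' D (j + 2)) * (L : ℂ) +
          betaJ c' D (j + 1) * betaJ c' D (j + 2) * (L : ℂ) ^ 2 / 2)‖ ≤
      ‖deriv χ.LFunction 1‖ * ‖PiW χ d r‖ * (1 + 2 * b₀ + b₀ ^ 2 / 2) := by
  rw [norm_mul, norm_mul]
  refine mul_le_mul_of_nonneg_left ?_ (by positivity)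
  have hLn : ‖(L : ℂ)‖ = L := by rw [Complex.norm_real, Real.norm_of_nonneg hL]
  have h1 : ‖(betaJ c' D (j + 1) + betaJ c' D (j + 2)) * (L : ℂ)‖ ≤ 2 * b₀ := by
    rw [norm_mul, hLn]
    calc ‖betaJ c' D (j + 1) + betaJ c' D (j + 2)‖ * L
        ≤ (‖betaJ c' D (j + 1)‖ + ‖betaJ c' D (j + 2)‖) * L := by
          gcongr; exact norm_add_le _ _
      _ = ‖betaJ c' D (j + 1)‖ * L + ‖betaJ c' D (j + 2)‖ * L := by ring
      _ ≤ b₀ + b₀ := add_le_add ha hb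
      _ = 2 * b₀ := by ring
  have h2 : ‖betaJ c' D (j + 1) * betaJ c' D (j + 2) * (L : ℂ) ^ 2 / 2‖ ≤ b₀ ^ 2 / 2 := by
    rw [norm_div, norm_mul, norm_mul, norm_pow, hLn, Complex.norm_ofNat]
    have : ‖betaJ c' D (j + 1)‖ * ‖betaJ c' D (j + 2)‖ * L ^ 2 ≤ b₀ ^ 2 := by
      calc ‖betaJ c' D (j + 1)‖ * ‖betaJ c' D (j + 2)‖ * L ^ 2
          = (‖betaJ c' D (j + 1)‖ * L) * (‖betaJ c' D (j + 2)‖ * L) := by ring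
        _ ≤ b₀ * b₀ := mul_le_mul ha hb (by positivity) hb₀
        _ = b₀ ^ 2 := by ring
    linarith
  calc ‖1 + (betaJ c' D (j + 1) + betaJ c' D (j + 2)) * (L : ℂ) +
          betaJ c' D (j + 1) * betaJ c' D (j + 2) * (L : ℂ) ^ 2 / 2‖
      ≤ ‖(1 : ℂ) + (betaJ c' D (j + 1) + betaJ c' D (j + 2)) * (L : ℂ)‖ +
          ‖betaJ c' D (j + 1) * betaJ c' D (j + 2) * (L : ℂ) ^ 2 / 2‖ := norm_add_le _ _
    _ ≤ (‖(1 : ℂ)‖ + ‖(betaJ c' D (j + 1) + betaJ c' D (j + 2)) * (L : ℂ)‖) +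
          ‖betaJ c' D (j + 1) * betaJ c' D (j + 2) * (L : ℂ) ^ 2 / 2‖ := by
        gcongr; exact norm_add_le _ _
    _ ≤ (1 + 2 * b₀) + b₀ ^ 2 / 2 := by rw [norm_one]; gcongr
    _ = 1 + 2 * b₀ + b₀ ^ 2 / 2 := by ring

end Pointwise

/-! ### The weak bound on `dr < P^{0.504}` and on the three windows of (10.11) -/

/-- A threshold `D₁` beyond which `log D ≥ M`. [folklore] -/
private theorem exists_nat_le_log'' (M : ℝ) : ∃ D₀ : ℕ, ∀ D : ℕ, D₀ ≤ D → M ≤ Real.log D := by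
  refine ⟨⌈Real.exp M⌉₊ + 1, fun D hD => ?_⟩
  have h1 : Real.exp M ≤ D := by
    have : (⌈Real.exp M⌉₊ : ℝ) + 1 ≤ D := by exact_mod_cast hD
    linarith [Nat.le_ceil (Real.exp M)]
  have hD0 : (0 : ℝ) < D := lt_of_lt_of_le (Real.exp_pos M) h1
  rw [Real.le_log_iff_exp_le hD0]
  exact h1

set_option maxHeartbeats 800000 in
/-- **The derivable form of (10.11) on `1 ≤ dr < P^{0.504}`** (a superset of the three edge windows):
under `Skeleton.Lemma83Rel c′` there is `C` with, for `D` large, (A), `1 ≤ j ≤ 3`, `d, r ≥ 1`,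
`dr < P^{0.504}`: `‖𝔳₂ⱼ(d,r)‖ ≤ C·𝓛(1 + 𝓛^{1.1})⁴(𝓛⁹)⁻¹·(∏_{q∣dr}(1−q⁻¹)⁻¹)²`. Each of the three
log-means of the tent decomposition is `0` (`X < 1`), `≪ 𝓛(1+log T)⁴` (`1 ≤ X ≤ T`, tail mean of
`ξ₀ⱼ`) or `≪ 𝓛²R` (`T ≤ X ≤ P`, LEMMA A). [cite: Zhang2022LandauSiegel, §10 Lemma 10.2 (10.11)] -/
theorem frakv2_low_le_of_lemma83Rel {c' : ℝ} (h83 : Lemma83Rel c') :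
    ∃ C : ℝ, ForAllLarge fun D _ χ => AssumptionA D χ → ∀ j ∈ ({1, 2, 3} : Finset ℕ), ∀ d r : ℕ,
      1 ≤ d → 1 ≤ r → ((d * r : ℕ) : ℝ) < bigP D ^ (0.504 : ℝ) →
        ‖frakv2 c' χ j d r‖ ≤
          C * (ell D * (1 + ell D ^ (1.1 : ℝ)) ^ 4 * (ell D ^ 9)⁻¹) *
            (∏ q ∈ (d * r).primeFactors, (1 - (q : ℝ)⁻¹)⁻¹) ^ 2 := by
  obtain ⟨CA, DA, hA⟩ := logMeanRel_of_lemma83Rel h83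
  obtain ⟨Cξ, Dξ, hξ⟩ := XiZeroMajorant.xiZeroTailMean c'
  obtain ⟨D₅, hD₅⟩ := exists_nat_le_log'' 5
  -- constants
  set b₀ : ℝ := 3 * π * (1 + 5 * |c'| * π) with hb₀
  have hb₀0 : 0 ≤ b₀ := by positivity
  set cb : ℝ := 1 + 2 * b₀ + b₀ ^ 2 / 2 with hcb
  have hcb1 : 1 ≤ cb := by rw [hcb]; nlinarith
  set K₁ : ℝ := 4 * Real.exp (9 / 2) * cb + |CA| + |Cξ| with hK₁
  have hK₁0 : 0 ≤ K₁ := by positivity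
  refine ⟨2000 * K₁, max (max DA Dξ) D₅, fun D _ χ hD hq hp hAA j hj d r hd hr hdr => ?_⟩
  have hDA : DA ≤ D := le_trans (le_trans (le_max_left _ _) (le_max_left _ _)) hD
  have hDξ : Dξ ≤ D := le_trans (le_trans (le_max_right _ _) (le_max_left _ _)) hD
  have hL5 : 5 ≤ ell D := by rw [ell]; exact hD₅ D (le_trans (le_max_right _ _) hD)
  set 𝓛 : ℝ := ell D with h𝓛def
  have h𝓛3 : 3 ≤ Real.log D := by rw [← ell, ← h𝓛def]; linarith
  have h𝓛1 : 1 ≤ 𝓛 := by linarith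
  have h𝓛0 : 0 < 𝓛 := by linarith
  have hD3 : 3 ≤ D := by
    by_contra h
    have hD2 : D ≤ 2 := by omega
    have : Real.log (D : ℝ) ≤ Real.log 2 := by
      rcases Nat.eq_zero_or_pos D with h0 | h0
      · rw [h0]; simp; exact Real.log_nonneg one_le_two
      · exact Real.log_le_log (by exact_mod_cast h0) (by exact_mod_cast hD2)
    have h2 : Real.log 2 < 1 := by
      have := Real.log_two_lt_d9; linarith
    linarith
  -- parameters
  have hP1 : 1 < bigP D := by rw [bigP]; exact Real.one_lt_exp_iff.2 (by positivity)
  have hP0 : 0 < bigP D := by linarith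
  have hlogP : Real.log (bigP D) = 𝓛 ^ 9 := by rw [bigP, Real.log_exp]
  obtain ⟨hτ2, hTP⟩ := bigT_lt_rpow (D := D) hL5
  have hT1 : 1 ≤ bigT D := by
    rw [bigT]; exact Real.one_le_exp (Real.rpow_nonneg (by linarith) _)
  have hT0 : 0 < bigT D := by linarith
  have hlogT : Real.log (bigT D) = 𝓛 ^ (1.1 : ℝ) := by rw [bigT, Real.log_exp]
  have hlogT0 : 0 ≤ Real.log (bigT D) := Real.log_nonneg hT1
  -- `y = dr`
  have hy1 : (1 : ℝ) ≤ ((d * r : ℕ) : ℝ) := by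
    have : 1 ≤ d * r := Nat.one_le_iff_ne_zero.mpr (Nat.mul_ne_zero (by omega) (by omega))
    exact_mod_cast this
  have hy0 : (0 : ℝ) < ((d * r : ℕ) : ℝ) := by linarith
  have hdrP1 : ((d * r : ℕ) : ℝ) < Skeleton.P1 D := hdr
  have hdrPT : ((d * r : ℕ) : ℝ) < bigP D / bigT D ^ 2 :=
    lt_trans hdrP1 (P1_lt_P_div_T_sq (D := D) (by linarith))
  -- the relative factor
  set R : ℝ := (∏ q ∈ (d * r).primeFactors, (1 - (q : ℝ)⁻¹)⁻¹) ^ 2 with hRdef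
  have hR1 : 1 ≤ R := by
    rw [hRdef]
    exact one_le_pow₀
      (Literature.NumberTheory.Sieve.GreenTao2008.GYCorr.one_le_prod_one_sub_inv_inv (d * r))
  have hR0 : 0 ≤ R := by linarith
  -- `|L′(1,χ)| ≤ 4e^{9/2}𝓛²`, `|Π| ≤ R`, `‖β_i‖𝓛⁹ ≤ b₀`
  have hℓ : ‖deriv χ.LFunction 1‖ ≤ 4 * Real.exp (9 / 2) * 𝓛 ^ 2 := by
    have h := Lemma31.norm_deriv_LFunction_le_near_one χ h𝓛3 hp (w := 1)
      (by rw [sub_self, norm_zero]; positivity)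
    rw [← ell, ← h𝓛def] at h
    refine h.trans ?_
    have h2 : (1 + 𝓛) * 𝓛 ≤ 2 * 𝓛 ^ 2 := by nlinarith
    have he := Real.exp_pos (9 / 2)
    calc 2 * Real.exp (9 / 2) * (1 + 𝓛) * 𝓛 = 2 * Real.exp (9 / 2) * ((1 + 𝓛) * 𝓛) := by ring
      _ ≤ 2 * Real.exp (9 / 2) * (2 * 𝓛 ^ 2) := by gcongr
      _ = 4 * Real.exp (9 / 2) * 𝓛 ^ 2 := by ring
  have hPi : ‖PiW χ d r‖ ≤ R := Lemma84.norm_PiW_le_prodInv χ (by omega) (by omega)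
  have hβ9 : ∀ i : ℕ, ‖betaJ c' D i‖ * 𝓛 ^ 9 ≤ b₀ := fun i =>
    Typed.Sec10A.norm_betaJ_mul_ell9_le c' hD3 i
  -- the uniform bound `B` for one log-mean with `X ≤ P^{0.504}/dr`
  set B : ℝ := (‖deriv χ.LFunction 1‖ * cb + |CA| * (𝓛 ^ 6)⁻¹) * R +
    |Cξ| * 𝓛 * (1 + 𝓛 ^ (1.1 : ℝ)) ^ 4 with hBdef
  have hBmain0 : 0 ≤ (‖deriv χ.LFunction 1‖ * cb + |CA| * (𝓛 ^ 6)⁻¹) * R := by positivity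
  have hBtail0 : 0 ≤ |Cξ| * 𝓛 * (1 + 𝓛 ^ (1.1 : ℝ)) ^ 4 := by positivity
  have hB0 : 0 ≤ B := by rw [hBdef]; positivity
  have hpiece : ∀ a : ℝ, a ≤ 0.504 →
      ‖∑ n ∈ Finset.Ioc 0 ⌊bigP D ^ a / ((d * r : ℕ) : ℝ)⌋₊,
          χ (n : ZMod D) * xiZero c' D j n d r / (n : ℂ) *
            (Real.log (bigP D ^ a / ((d * r : ℕ) : ℝ) / n) : ℂ)‖ ≤ B := by
    intro a ha
    set X : ℝ := bigP D ^ a / ((d * r : ℕ) : ℝ) with hXdef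
    have hXP : X ≤ bigP D := by
      calc X ≤ bigP D ^ a := div_le_self (by positivity) hy1
        _ ≤ bigP D ^ (1 : ℝ) := Real.rpow_le_rpow_of_exponent_le hP1.le (by linarith)
        _ = bigP D := Real.rpow_one _
    rcases lt_or_ge X 1 with hX1 | hX1
    · -- `X < 1`: the log-mean vanishes
      rw [logMean_eq_zero_of_lt_one (fun n => χ (n : ZMod D) * xiZero c' D j n d r / (n : ℂ)) hX1,
        norm_zero]
      exact hB0
    have hX0 : 0 < X := by linarith
    have hlogX0 : 0 ≤ Real.log X := Real.log_nonneg hX1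
    rcases le_or_gt X (bigT D) with hXT | hXT
    · -- `1 ≤ X ≤ T`: the tail mean
      have htail := hξ D χ hDξ hq hp j hj d r hd hr hdrP1 X hX1 hXT
      have hlogXT : Real.log X ≤ 𝓛 ^ (1.1 : ℝ) := by
        rw [← hlogT]; exact Real.log_le_log hX0 hXT
      have hsum0 : 0 ≤ ∑ n ∈ Finset.Ico 1 ⌈X⌉₊, ‖xiZero c' D j n d r‖ / n :=
        Finset.sum_nonneg fun n _ => by positivity
      calc _ ≤ Real.log X * ∑ n ∈ Finset.Ico 1 ⌈X⌉₊, ‖xiZero c' D j n d r‖ / n :=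
            norm_logMean_le_log_mul_tail c' χ j d r hX1
        _ ≤ Real.log X * (Cξ * ell D * (1 + Real.log X) ^ 3) :=
            mul_le_mul_of_nonneg_left htail hlogX0
        _ ≤ Real.log X * (|Cξ| * ell D * (1 + Real.log X) ^ 3) := by
            gcongr; exact le_abs_self _
        _ ≤ (1 + 𝓛 ^ (1.1 : ℝ)) * (|Cξ| * 𝓛 * (1 + 𝓛 ^ (1.1 : ℝ)) ^ 3) := by
            rw [← h𝓛def]
            apply mul_le_mul (by linarith) _ (by positivity) (by positivity)
            gcongr
        _ = |Cξ| * 𝓛 * (1 + 𝓛 ^ (1.1 : ℝ)) ^ 4 := by ring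
        _ ≤ B := by rw [hBdef]; linarith [hBmain0]
    · -- `T < X ≤ P`: LEMMA A
      have hAX := hA D χ hDA hq hp hAA j hj d r hd hr hdrPT X hXT.le hXP
      have hlogXP : Real.log X ≤ 𝓛 ^ 9 := by
        rw [← hlogP]; exact Real.log_le_log hX0 hXP
      have hβL : ∀ i : ℕ, ‖betaJ c' D i‖ * Real.log X ≤ b₀ := fun i =>
        le_trans (mul_le_mul_of_nonneg_left hlogXP (norm_nonneg _)) (hβ9 i)
      have hmain := norm_logMean_main_le c' χ j d r hlogX0 hb₀0 (hβL (j + 1)) (hβL (j + 2))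
      calc _ ≤ ‖(∑ n ∈ Finset.Ioc 0 ⌊X⌋₊, χ (n : ZMod D) * xiZero c' D j n d r / (n : ℂ) *
                (Real.log (X / n) : ℂ)) -
              deriv χ.LFunction 1 * PiW χ d r *
                (1 + (betaJ c' D (j + 1) + betaJ c' D (j + 2)) * (Real.log X : ℂ) +
                  betaJ c' D (j + 1) * betaJ c' D (j + 2) * (Real.log X : ℂ) ^ 2 / 2)‖ +
            ‖deriv χ.LFunction 1 * PiW χ d r *
                (1 + (betaJ c' D (j + 1) + betaJ c' D (j + 2)) * (Real.log X : ℂ) +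
                  betaJ c' D (j + 1) * betaJ c' D (j + 2) * (Real.log X : ℂ) ^ 2 / 2)‖ :=
            norm_le_norm_sub_add _ _
        _ ≤ CA * (ell D ^ 6)⁻¹ * R + ‖deriv χ.LFunction 1‖ * ‖PiW χ d r‖ * cb :=
            add_le_add hAX hmain
        _ ≤ |CA| * (𝓛 ^ 6)⁻¹ * R + ‖deriv χ.LFunction 1‖ * R * cb := by
            rw [← h𝓛def]
            gcongr
            exact le_abs_self _
        _ = (‖deriv χ.LFunction 1‖ * cb + |CA| * (𝓛 ^ 6)⁻¹) * R := by ring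
        _ ≤ B := by rw [hBdef]; linarith [hBtail0]
  -- the tent decomposition and the sum of the three pieces
  have hdec := frakv2_eq_logMeans (χ := χ) c' j hd hr hP1
  have h1 := hpiece 0.504 le_rfl
  have h2 := hpiece 0.502 (by norm_num)
  have h3 := hpiece 0.5 (by norm_num)
  have hcoef : ‖(((500 / Real.log (bigP D) : ℝ)) : ℂ)‖ = 500 / 𝓛 ^ 9 := by
    rw [Complex.norm_real, hlogP, Real.norm_of_nonneg (by positivity)]
  have hv : ‖frakv2 c' χ j d r‖ ≤ 500 / 𝓛 ^ 9 * (4 * B) := by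
    rw [hdec, norm_mul, hcoef]
    refine mul_le_mul_of_nonneg_left ?_ (by positivity)
    calc _ ≤ ‖(∑ n ∈ Finset.Ioc 0 ⌊bigP D ^ (0.504 : ℝ) / ((d * r : ℕ) : ℝ)⌋₊,
              χ (n : ZMod D) * xiZero c' D j n d r / (n : ℂ) *
                (Real.log (bigP D ^ (0.504 : ℝ) / ((d * r : ℕ) : ℝ) / n) : ℂ)) -
            2 * (∑ n ∈ Finset.Ioc 0 ⌊bigP D ^ (0.502 : ℝ) / ((d * r : ℕ) : ℝ)⌋₊,
              χ (n : ZMod D) * xiZero c' D j n d r / (n : ℂ) *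
                (Real.log (bigP D ^ (0.502 : ℝ) / ((d * r : ℕ) : ℝ) / n) : ℂ))‖ +
            ‖∑ n ∈ Finset.Ioc 0 ⌊bigP D ^ (0.5 : ℝ) / ((d * r : ℕ) : ℝ)⌋₊,
              χ (n : ZMod D) * xiZero c' D j n d r / (n : ℂ) *
                (Real.log (bigP D ^ (0.5 : ℝ) / ((d * r : ℕ) : ℝ) / n) : ℂ)‖ := norm_add_le _ _
      _ ≤ (B + 2 * B) + B := by
          gcongr
          · calc _ ≤ ‖∑ n ∈ Finset.Ioc 0 ⌊bigP D ^ (0.504 : ℝ) / ((d * r : ℕ) : ℝ)⌋₊,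
                    χ (n : ZMod D) * xiZero c' D j n d r / (n : ℂ) *
                      (Real.log (bigP D ^ (0.504 : ℝ) / ((d * r : ℕ) : ℝ) / n) : ℂ)‖ +
                  ‖2 * (∑ n ∈ Finset.Ioc 0 ⌊bigP D ^ (0.502 : ℝ) / ((d * r : ℕ) : ℝ)⌋₊,
                    χ (n : ZMod D) * xiZero c' D j n d r / (n : ℂ) *
                      (Real.log (bigP D ^ (0.502 : ℝ) / ((d * r : ℕ) : ℝ) / n) : ℂ))‖ :=
                  norm_sub_le _ _
              _ ≤ B + 2 * B := by
                  rw [norm_mul, Complex.norm_ofNat]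
                  gcongr
      _ = 4 * B := by ring
  refine hv.trans ?_
  -- bookkeeping: `2000B/𝓛⁹ ≤ 2000K₁·𝓛(1+𝓛^{1.1})⁴(𝓛⁹)⁻¹·R`
  set W : ℝ := 𝓛 * (1 + 𝓛 ^ (1.1 : ℝ)) ^ 4 with hWdef
  have hτ1 : 𝓛 ≤ 𝓛 ^ (1.1 : ℝ) := by
    calc 𝓛 = 𝓛 ^ (1 : ℝ) := (Real.rpow_one _).symm
      _ ≤ 𝓛 ^ (1.1 : ℝ) := Real.rpow_le_rpow_of_exponent_le h𝓛1 (by norm_num)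
  have h1τ : 1 ≤ 1 + 𝓛 ^ (1.1 : ℝ) := by linarith
  have hW1 : 𝓛 ^ 2 ≤ W := by
    rw [hWdef]
    have h4 : 𝓛 ≤ (1 + 𝓛 ^ (1.1 : ℝ)) ^ 4 := by
      calc 𝓛 ≤ 1 + 𝓛 ^ (1.1 : ℝ) := by linarith
        _ ≤ (1 + 𝓛 ^ (1.1 : ℝ)) ^ 4 := le_self_pow₀ h1τ (by norm_num)
    calc 𝓛 ^ 2 = 𝓛 * 𝓛 := by ring
      _ ≤ 𝓛 * (1 + 𝓛 ^ (1.1 : ℝ)) ^ 4 := by gcongr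
  have hW2 : 1 ≤ W := le_trans (by nlinarith) hW1
  have hW0 : 0 ≤ W := by linarith
  have hBle : B ≤ K₁ * W * R := by
    rw [hBdef, hK₁]
    have e1 : ‖deriv χ.LFunction 1‖ * cb * R ≤ 4 * Real.exp (9 / 2) * cb * W * R := by
      have : ‖deriv χ.LFunction 1‖ * cb ≤ 4 * Real.exp (9 / 2) * cb * W := by
        calc ‖deriv χ.LFunction 1‖ * cb ≤ 4 * Real.exp (9 / 2) * 𝓛 ^ 2 * cb := by gcongr
          _ ≤ 4 * Real.exp (9 / 2) * W * cb := by gcongr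
          _ = 4 * Real.exp (9 / 2) * cb * W := by ring
      exact mul_le_mul_of_nonneg_right this hR0
    have e2 : |CA| * (𝓛 ^ 6)⁻¹ * R ≤ |CA| * W * R := by
      have h6 : (𝓛 ^ 6)⁻¹ ≤ 1 := inv_le_one_of_one_le₀ (one_le_pow₀ h𝓛1)
      have : |CA| * (𝓛 ^ 6)⁻¹ ≤ |CA| * W := by
        calc |CA| * (𝓛 ^ 6)⁻¹ ≤ |CA| * 1 := by gcongr
          _ ≤ |CA| * W := by gcongr
      exact mul_le_mul_of_nonneg_right this hR0
    have e3 : |Cξ| * 𝓛 * (1 + 𝓛 ^ (1.1 : ℝ)) ^ 4 ≤ |Cξ| * W * R := by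
      calc |Cξ| * 𝓛 * (1 + 𝓛 ^ (1.1 : ℝ)) ^ 4 = |Cξ| * W * 1 := by rw [hWdef]; ring
        _ ≤ |Cξ| * W * R := by gcongr
    calc (‖deriv χ.LFunction 1‖ * cb + |CA| * (𝓛 ^ 6)⁻¹) * R + |Cξ| * 𝓛 * (1 + 𝓛 ^ (1.1 : ℝ)) ^ 4
        = ‖deriv χ.LFunction 1‖ * cb * R + |CA| * (𝓛 ^ 6)⁻¹ * R +
            |Cξ| * 𝓛 * (1 + 𝓛 ^ (1.1 : ℝ)) ^ 4 := by ring
      _ ≤ 4 * Real.exp (9 / 2) * cb * W * R + |CA| * W * R + |Cξ| * W * R :=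
          add_le_add (add_le_add e1 e2) e3
      _ = (4 * Real.exp (9 / 2) * cb + |CA| + |Cξ|) * W * R := by ring
  calc 500 / 𝓛 ^ 9 * (4 * B) ≤ 500 / 𝓛 ^ 9 * (4 * (K₁ * W * R)) := by gcongr
    _ = 2000 * K₁ * (W * (𝓛 ^ 9)⁻¹) * R := by rw [div_eq_mul_inv]; ring
    _ = 2000 * K₁ * (𝓛 * (1 + 𝓛 ^ (1.1 : ℝ)) ^ 4 * (𝓛 ^ 9)⁻¹) * R := by rw [hWdef]

/-- **The derivable form of (10.11) on the three edge windows** (hypothesis shaped as clause 4 of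
`Skeleton.Lemma102 c′`: `dr ∈ (P^{0.5}/T, P^{0.5}] ∪ (P^{0.502}/T, P^{0.502}] ∪ (P^{0.504}/T, P^{0.504})`):
under `Skeleton.Lemma83Rel c′`, for `D` large, (A), `1 ≤ j ≤ 3`, `d, r ≥ 1`,
`‖𝔳₂ⱼ(d,r)‖ ≤ C·𝓛(1 + 𝓛^{1.1})⁴(𝓛⁹)⁻¹·(∏_{q∣dr}(1−q⁻¹)⁻¹)²` (each window lies below `P^{0.504}`).
The printed `O(𝓛⁻⁷)` is not claimed (row G-d60-1). [cite: Zhang2022LandauSiegel, §10 Lemma 10.2 (10.11)] -/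
theorem frakv2_windows_le_of_lemma83Rel {c' : ℝ} (h83 : Lemma83Rel c') :
    ∃ C : ℝ, ForAllLarge fun D _ χ => AssumptionA D χ → ∀ j ∈ ({1, 2, 3} : Finset ℕ), ∀ d r : ℕ,
      1 ≤ d → 1 ≤ r →
        ((bigP D ^ (0.5 : ℝ) / bigT D < ((d * r : ℕ) : ℝ) ∧ ((d * r : ℕ) : ℝ) ≤ bigP D ^ (0.5 : ℝ)) ∨
          (bigP D ^ (0.502 : ℝ) / bigT D < ((d * r : ℕ) : ℝ) ∧
            ((d * r : ℕ) : ℝ) ≤ bigP D ^ (0.502 : ℝ)) ∨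
          (bigP D ^ (0.504 : ℝ) / bigT D < ((d * r : ℕ) : ℝ) ∧
            ((d * r : ℕ) : ℝ) < bigP D ^ (0.504 : ℝ))) →
        ‖frakv2 c' χ j d r‖ ≤
          C * (ell D * (1 + ell D ^ (1.1 : ℝ)) ^ 4 * (ell D ^ 9)⁻¹) *
            (∏ q ∈ (d * r).primeFactors, (1 - (q : ℝ)⁻¹)⁻¹) ^ 2 := by
  obtain ⟨C, D₀, h⟩ := frakv2_low_le_of_lemma83Rel h83
  obtain ⟨D₅, hD₅⟩ := exists_nat_le_log'' 5
  refine ⟨C, max D₀ D₅, fun D _ χ hD hq hp hA j hj d r hd hr hwin => ?_⟩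
  have hD₀ : D₀ ≤ D := le_trans (le_max_left _ _) hD
  have hL5 : 5 ≤ ell D := by rw [ell]; exact hD₅ D (le_trans (le_max_right _ _) hD)
  have hP1 : 1 < bigP D := by
    rw [bigP]; exact Real.one_lt_exp_iff.2 (by positivity)
  have hlt : ∀ {a : ℝ}, a < 0.504 → bigP D ^ a < bigP D ^ (0.504 : ℝ) := fun ha =>
    Real.rpow_lt_rpow_of_exponent_lt hP1 ha
  refine h D χ hD₀ hq hp hA j hj d r hd hr ?_
  rcases hwin with ⟨-, h1⟩ | ⟨-, h2⟩ | ⟨-, h3⟩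
  · exact lt_of_le_of_lt h1 (hlt (by norm_num))
  · exact lt_of_le_of_lt h2 (hlt (by norm_num))
  · exact h3

end Literature.NumberTheory.LFunctions.Zhang2022.Lemma102
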